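import Mathlib
import HarnessLib

/-!
# Crux `Steer` (stmt-ResolutionOfSingularities-16345), chain W4.1 — hK4′ β-leaf, K-β1♭ Brick I (W2)/LOW branch: LEMMA V (explicit form) —
# visibility of low translations for odd-degree binary forms in characteristic 2

OURS (campaign `res-hironaka`, rung L ★L-G4, slot W4.1). AUTHOR of the mathematics and of the kernel text: res-L0-w41-idea-1 g10
(`L/res-L0-w41-idea-1/LemmaV-idea-1-g10.lean` c366bcc3bf405f7f, memo `CANONICAL-CLEANING-g10.md` §3); LANDED by res-L0-w41-stub-1 g4 (K-β1♭ owner)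
at idea-1's request (planners do not propose to Theorems/) — contents identical modulo namespace, header, docstrings and lint hygiene. Audited
context: res-L0-w41-tri-2 g7 TRIAGE v20 `beta18/audit_150a_kbeta1.md` 3b2fa71c4617380f §1.8/§2.1 (the LOW branch of the trichotomy rests on this
identity). They replace the role of no printed item and are NOT statements of the manuscript under review [claim: Hironaka2017, status: under-review];
AI review is weaker than expert review. Mathlib-only; no Theses import; nothing here is a route item or a registration.

For a binary form `Ψ(Z, W)` of degree `d ≥ 1` over a commutative ring and `c = (c₀, c₁)`, in the translate `T := Ψ(Z + c₀ M, W + c₁ M)`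
(variables `Z = X 0`, `W = X 1`, `M = X 2`):

  `d · Ψ(c) = c₀ · coeff_{Z M^{d-1}} T + c₁ · coeff_{W M^{d-1}} T`            (`euler_translate`)

(derivative-free: substitute the line `Z = c₀ t, W = c₁ t, M = s` and read off the coefficient of `t s^{d-1}` in `Ψ(c) (t + s)^d` two ways).
In characteristic 2 with `d` odd, `d · Ψ(c) = Ψ(c)`, so `Ψ(c) ≠ 0` forces one of the two monomials `Z M^{d-1}`, `W M^{d-1}` — of ODD
`(Z, W)`-class, hence surviving every cleaning `f ↦ f + u q²` — to be present: `lowTranslationVisible_holds` (the word `LowTranslationVisible` is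
res-L0-w41-idea-1's v18 §8 VERBATIM). [cite: CossartJannsenSaito2020, Lemma 7.11] [folklore]
-/

-- `Summit.<S>.<S>.…` duplicates the summit name by design (single-problem summit).
set_option linter.dupNamespace false
set_option autoImplicit false

namespace Summit.ResolutionOfSingularities.ResolutionOfSingularities.Theorems.SwitchingDichotomy.BetaPolygon.LemmaV

open MvPolynomial

variable {κ : Type} [CommRing κ]

/-- The translation substitution `Z ↦ Z + c₀ M`, `W ↦ W + c₁ M`. -/
noncomputable def transl (c : Fin 2 → κ) : Fin 2 → MvPolynomial (Fin 3) κ :=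
  fun n => X (Fin.castSucc n) + C (c n) * X (2 : Fin 3)

/-- The line substitution `Z ↦ c₀ t`, `W ↦ c₁ t`, `M ↦ s` (`t = X 0`, `s = X 1`). -/
noncomputable def lineSub (c : Fin 2 → κ) : Fin 3 → MvPolynomial (Fin 2) κ :=
  Fin.lastCases (X 1) (fun j : Fin 2 => C (c j) * X 0)

/-- `lineSub c 0 = c₀·t`. OURS. [folklore] -/
@[simp] theorem lineSub_zero (c : Fin 2 → κ) : lineSub c 0 = C (c 0) * X 0 := by
  have h := Fin.lastCases_castSucc (motive := fun _ : Fin 3 => MvPolynomial (Fin 2) κ)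
    (last := X 1) (cast := fun j : Fin 2 => C (c j) * X 0) 0
  simpa [lineSub] using h

/-- `lineSub c 1 = c₁·t`. OURS. [folklore] -/
@[simp] theorem lineSub_one (c : Fin 2 → κ) : lineSub c 1 = C (c 1) * X 0 := by
  have h := Fin.lastCases_castSucc (motive := fun _ : Fin 3 => MvPolynomial (Fin 2) κ)
    (last := X 1) (cast := fun j : Fin 2 => C (c j) * X 0) 1
  simpa [lineSub] using h

/-- `lineSub c 2 = s`. OURS. [folklore] -/
@[simp] theorem lineSub_two (c : Fin 2 → κ) : lineSub c 2 = X 1 :=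
  Fin.lastCases_last (motive := fun _ : Fin 3 => MvPolynomial (Fin 2) κ)
    (last := X 1) (cast := fun j : Fin 2 => C (c j) * X 0)

/-- Composite substitution: translating then restricting to the line gives `Ψ(c₀ (t+s), c₁ (t+s))`. -/
theorem aeval_lineSub_transl (c : Fin 2 → κ) (Ψ : MvPolynomial (Fin 2) κ) :
    aeval (lineSub c) (aeval (transl c) Ψ) = aeval (fun n => C (c n) * (X 0 + X 1)) Ψ := by
  rw [← AlgHom.comp_apply, comp_aeval]
  have hfun : (fun i => aeval (lineSub c) (transl c i)) =
      (fun n => C (c n) * (X 0 + X 1 : MvPolynomial (Fin 2) κ)) := by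
    funext n
    fin_cases n <;> simp [transl] <;> ring
  rw [hfun]

/-- `C a · X₀^i · X₁^j` is a monomial. -/
theorem C_mul_X_pow_mul_X_pow (a : κ) (i j : ℕ) :
    C a * (X 0 ^ i * X 1 ^ j : MvPolynomial (Fin 2) κ) =
      monomial (Finsupp.single 0 i + Finsupp.single 1 j) a := by
  rw [X_pow_eq_monomial, X_pow_eq_monomial, monomial_mul, C_mul_monomial]
  simp

/-- Homogeneity: `Ψ(c₀ R, c₁ R) = Ψ(c) · R^d`. -/
theorem aeval_C_mul_of_isHomogeneous {d : ℕ} {Ψ : MvPolynomial (Fin 2) κ} (hΨ : Ψ.IsHomogeneous d)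
    (c : Fin 2 → κ) (R : MvPolynomial (Fin 2) κ) :
    aeval (fun n => C (c n) * R) Ψ = C (eval c Ψ) * R ^ d := by
  classical
  conv_lhs => rw [Ψ.as_sum, map_sum]
  rw [eval_eq', map_sum, Finset.sum_mul]
  refine Finset.sum_congr rfl fun e he => ?_
  have hdeg : e.degree = d := by
    by_contra hne
    exact (mem_support_iff.mp he) (hΨ.coeff_eq_zero hne)
  rw [Finsupp.degree_eq_sum, Fin.sum_univ_two] at hdeg
  rw [aeval_monomial, algebraMap_eq, Finsupp.prod_fintype _ _ (fun i => pow_zero _),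
    Fin.prod_univ_two, Fin.prod_univ_two, map_mul, map_mul, map_pow, map_pow, ← hdeg]
  ring

/-- The coefficient of `t · s^{d-1}` in `C a · (t + s)^d` is `a · d`. -/
theorem coeff_C_mul_X_add_X_pow (a : κ) {d : ℕ} (hd : 1 ≤ d) :
    coeff (Finsupp.single 0 1 + Finsupp.single 1 (d - 1))
      (C a * (X 0 + X 1 : MvPolynomial (Fin 2) κ) ^ d) = a * d := by
  classical
  have hterm : ∀ m : ℕ, C a * (X 0 ^ m * X 1 ^ (d - m) * (d.choose m : MvPolynomial (Fin 2) κ))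
      = monomial (Finsupp.single 0 m + Finsupp.single 1 (d - m)) (a * d.choose m) := fun m => by
    rw [← map_natCast (C : κ →+* MvPolynomial (Fin 2) κ), ← C_mul_X_pow_mul_X_pow, map_mul]
    ring
  rw [add_pow, Finset.mul_sum, coeff_sum]
  simp_rw [hterm, coeff_monomial]
  rw [Finset.sum_eq_single 1]
  · rw [if_pos rfl, Nat.choose_one_right]
  · intro m _ hm1
    rw [if_neg]
    intro h
    have h0 := DFunLike.congr_fun h 0
    simp at h0
    exact hm1 h0
  · intro h
    exact absurd (Finset.mem_range.mpr (by omega)) h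

/-- Exponent projection of the line substitution: `Z^i W^j M^k ↦ t^{i+j} s^k`. -/
noncomputable def proj (m : Fin 3 →₀ ℕ) : Fin 2 →₀ ℕ :=
  Finsupp.single 0 (m 0 + m 1) + Finsupp.single 1 (m 2)

/-- The line substitution on a monomial. -/
theorem aeval_lineSub_monomial (c : Fin 2 → κ) (m : Fin 3 →₀ ℕ) (a : κ) :
    aeval (lineSub c) (monomial m a) = monomial (proj m) (a * c 0 ^ m 0 * c 1 ^ m 1) := by
  rw [aeval_monomial, algebraMap_eq, Finsupp.prod_fintype _ _ (fun i => pow_zero _),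
    Fin.prod_univ_three, lineSub_zero, lineSub_one, lineSub_two, proj, ← C_mul_X_pow_mul_X_pow,
    map_mul, map_mul, map_pow, map_pow, pow_add]
  ring

/-- The fibre of `proj` over `t s^{d-1}` consists of `Z M^{d-1}` and `W M^{d-1}`. -/
theorem proj_eq_iff (m : Fin 3 →₀ ℕ) (d : ℕ) :
    proj m = Finsupp.single 0 1 + Finsupp.single 1 (d - 1) ↔
      m = Finsupp.single 0 1 + Finsupp.single 2 (d - 1) ∨
        m = Finsupp.single 1 1 + Finsupp.single 2 (d - 1) := by
  classical
  constructor
  · intro h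
    have h0 := DFunLike.congr_fun h 0
    have h1 := DFunLike.congr_fun h 1
    simp only [proj, Finsupp.add_apply, Finsupp.single_apply] at h0 h1
    simp at h0 h1
    rcases Nat.eq_zero_or_pos (m 0) with hm0 | hm0
    · right
      ext i
      fin_cases i <;> simp <;> omega
    · left
      ext i
      fin_cases i <;> simp <;> omega
  · rintro (rfl | rfl) <;> ext i <;> fin_cases i <;> simp [proj]

/-- **Derivative-free Euler identity for the translate** (any commutative ring, `d ≥ 1`):
`d · Ψ(c) = c₀ · coeff_{Z M^{d-1}} Ψ(Z + c₀M, W + c₁M) + c₁ · coeff_{W M^{d-1}} Ψ(Z + c₀M, W + c₁M)`. -/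
theorem euler_translate {d : ℕ} (hd : 1 ≤ d) (Ψ : MvPolynomial (Fin 2) κ)
    (hΨ : Ψ.IsHomogeneous d) (c : Fin 2 → κ) :
    (d : κ) * eval c Ψ =
      c 0 * coeff (Finsupp.single 0 1 + Finsupp.single 2 (d - 1)) (aeval (transl c) Ψ) +
        c 1 * coeff (Finsupp.single 1 1 + Finsupp.single 2 (d - 1)) (aeval (transl c) Ψ) := by
  classical
  set T := aeval (transl c) Ψ with hT
  set n₀ : Fin 2 →₀ ℕ := Finsupp.single 0 1 + Finsupp.single 1 (d - 1) with hn₀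
  set m₁ : Fin 3 →₀ ℕ := Finsupp.single 0 1 + Finsupp.single 2 (d - 1) with hm₁
  set m₂ : Fin 3 →₀ ℕ := Finsupp.single 1 1 + Finsupp.single 2 (d - 1) with hm₂
  -- (1) via homogeneity: the coefficient of `t s^{d-1}` in `Ψ(c)(t+s)^d`
  have h1 : coeff n₀ (aeval (lineSub c) T) = eval c Ψ * d := by
    rw [hT, aeval_lineSub_transl, aeval_C_mul_of_isHomogeneous hΨ, hn₀, coeff_C_mul_X_add_X_pow _ hd]
  -- (2) via the monomial expansion of `T`
  have hne : m₁ ≠ m₂ := by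
    intro h
    have := DFunLike.congr_fun h 0
    simp [hm₁, hm₂] at this
  set T' := T - monomial m₁ (coeff m₁ T) - monomial m₂ (coeff m₂ T) with hT'
  have hsplit : T = T' + monomial m₁ (coeff m₁ T) + monomial m₂ (coeff m₂ T) := by
    rw [hT']; ring
  have hc1 : coeff m₁ T' = 0 := by
    rw [hT', coeff_sub, coeff_sub, coeff_monomial, coeff_monomial, if_pos rfl, if_neg hne.symm]
    ring
  have hc2 : coeff m₂ T' = 0 := by
    rw [hT', coeff_sub, coeff_sub, coeff_monomial, coeff_monomial, if_neg hne, if_pos rfl]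
    ring
  have hzero : coeff n₀ (aeval (lineSub c) T') = 0 := by
    conv_lhs => rw [T'.as_sum, map_sum, coeff_sum]
    refine Finset.sum_eq_zero fun m hm => ?_
    rw [aeval_lineSub_monomial, coeff_monomial, if_neg]
    intro h
    rcases (proj_eq_iff m d).mp (h.trans hn₀.symm ▸ h) with h' | h'
    · exact (mem_support_iff.mp hm) (h' ▸ hc1)
    · exact (mem_support_iff.mp hm) (h' ▸ hc2)
  have hp1 : proj m₁ = n₀ := (proj_eq_iff m₁ d).mpr (Or.inl rfl)
  have hp2 : proj m₂ = n₀ := (proj_eq_iff m₂ d).mpr (Or.inr rfl)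
  have h2 : coeff n₀ (aeval (lineSub c) T) = c 0 * coeff m₁ T + c 1 * coeff m₂ T := by
    rw [hsplit, map_add, map_add, coeff_add, coeff_add, hzero, aeval_lineSub_monomial,
      aeval_lineSub_monomial, coeff_monomial, coeff_monomial, if_pos hp1, if_pos hp2]
    rw [← hsplit]
    simp [hm₁, hm₂]
    ring
  rw [mul_comm]
  exact h1.symm.trans h2

/-- v18 §8, VERBATIM (`Sketch-idea-1-v18-hatleaf.lean`, decl `LowTranslationVisible`). -/
def LowTranslationVisible : Prop :=
  ∀ (κ : Type) [Field κ] [CharP κ 2] (d : ℕ) (Ψ : MvPolynomial (Fin 2) κ) (c : Fin 2 → κ),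
    Odd d → 3 ≤ d → Ψ.IsHomogeneous d → MvPolynomial.eval c Ψ ≠ 0 →
    ∃ i j k : ℕ, 1 ≤ k ∧ ¬ (2 ∣ i ∧ 2 ∣ j) ∧
      MvPolynomial.coeff (Finsupp.single 0 i + Finsupp.single 1 j + Finsupp.single 2 k)
        (MvPolynomial.aeval
          (fun n : Fin 2 => (X (Fin.castSucc n) + C (c n) * X (2 : Fin 3) : MvPolynomial (Fin 3) κ)) Ψ) ≠ 0

/-- **LEMMA V** (v18 §8 `LowTranslationVisible`), with the explicit witness `k = d - 1`,
`(i, j) ∈ {(1,0), (0,1)}`. -/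
theorem lowTranslationVisible_holds : LowTranslationVisible := by
  intro κ _ _ d Ψ c hodd h3 hΨ hc
  classical
  have hd1 : (d : κ) = 1 := by
    obtain ⟨k, rfl⟩ := hodd
    have h2 : (2 : κ) = 0 := by
      have := CharP.cast_eq_zero κ 2
      simpa using this
    push_cast
    rw [h2]; ring
  have key := euler_translate (κ := κ) (by omega : 1 ≤ d) Ψ hΨ c
  rw [hd1, one_mul] at key
  by_contra hnone
  have e1 : coeff (Finsupp.single 0 1 + Finsupp.single 1 0 + Finsupp.single 2 (d - 1))
      (aeval (transl c) Ψ) = 0 := by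
    by_contra h
    exact hnone ⟨1, 0, d - 1, by omega, by omega, h⟩
  have e2 : coeff (Finsupp.single 0 0 + Finsupp.single 1 1 + Finsupp.single 2 (d - 1))
      (aeval (transl c) Ψ) = 0 := by
    by_contra h
    exact hnone ⟨0, 1, d - 1, by omega, by omega, h⟩
  rw [Finsupp.single_zero, add_zero] at e1
  rw [Finsupp.single_zero, zero_add] at e2
  apply hc
  rw [key, e1, e2]
  ring

end Summit.ResolutionOfSingularities.ResolutionOfSingularities.Theorems.SwitchingDichotomy.BetaPolygon.LemmaV
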